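import Literature.Analysis.UnboundedOperators.LinearizedBoltzmannQuarticAbsorption
import HarnessLib

/-!
# The Chapman–Enskog inverse of the linearised hard-sphere operator in `ℝ³` with polynomial growth

For the linearised hard-sphere operator `L` around the normalised Maxwellian `M` of `ℝ³`
(`hardSphereLinearizedOp`, `M dv = stdGaussian`; CIP 1994 §7.2) the tree provides, for every bounded
continuous `g ⊥_M span {1, v, |v|²}`, a continuous `M`-orthogonal solution `ψ₀ ∈ L²(M dv)` of `L ψ₀ = g`
with the Gaussian growth `|ψ₀(v)| ≤ C₀ ‖g‖_∞ e^{|v|²/4}` (`exists_continuous_inverse_hardSphereLinearizedOp`).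
Here this is improved to the polynomial bound **`|ψ₀(v)| ≤ C ‖g‖_∞ (1 + |v|²)²`** with an ABSOLUTE
constant `C` (`exists_abs_le_mul_quartic_of_fixedPoint`, `exists_continuous_inverse_hardSphereLinearizedOp_quartic`):
the weighted sup-norm theory of `L⁻¹` (Grad 1963; Caflisch 1980; Guo, ARMA 197 (2010)) in the
`M`-weighted picture with the quartic weight `Φ = (1 + |·|²)²`, a strict supersolution of Grad's integral
equation at large speed because `ν⁻¹ K₂ Φ → (2/3) Φ` (`LinearizedBoltzmannQuarticWeightAction`, sharp
`ν ≥ π|v|`). Truncation `W_N = max (Φ, e^{|·|²/4}/N)` makes the a-priori bound part of the weight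
(`m_N = sup |ψ₀|/W_N ≤ C₀ ‖g‖_∞ N`), the absorption step (`LinearizedBoltzmannQuarticAbsorption`) gives
`m_N ≤ (3/4) m_N + D`, hence `m_N ≤ 4D` uniformly in `N`, and `N → ∞`.

Sharpness: by `LinearizedBoltzmannOrthogonalInverseUnbounded` this `M`-orthogonal `ψ₀` is in general
unbounded — it carries a non-trivial element of `span {v, |v|² - 3}` — so the exponent of `(1 + |v|²)`
cannot be `0`; the method gives every exponent `> 1` (here `2`), the true one being `1`. Whether SOME
(non-orthogonal) bounded pre-image exists for every bounded `g ⊥` invariants is a finer open question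
(Kondrat'ev-type asymptotics through the indicial roots `α = 2` (energy) and `α = 1` (momentum)).
No new definitions are introduced.
-/

open MeasureTheory Metric Real Set Filter Topology ProbabilityTheory Module
open scoped InnerProductSpace ENNReal

namespace Literature.Analysis.UnboundedOperators

noncomputable section

open Literature.MathematicalPhysics.KineticTheory (collide sphereMeasure hardSphereKernel)
open Literature.Analysis.FluidPDE

/-! ### The Chapman–Enskog inverse with polynomial growth -/

/-- **Polynomial growth of the Chapman–Enskog inverse (a-priori estimate, `ℝ³`).** There is an
absolute constant `C` such that: if `ψ` is measurable with the Gaussian growth `|ψ(x)| ≤ A e^{|x|²/4}`,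
`ψ ∈ L²(M dv)` with `‖ψ‖_{L²(M)} ≤ B`, `|g| ≤ b`, and `ψ` solves Grad's integral equation
`ν ψ = ∫∫ B (ψ' + ψ_*' - ψ_*) dω dM_* - g` pointwise, then **`|ψ(v)| ≤ C (A + B + b) (1 + |v|²)²`** for
every `v`. The quartic weight `Φ = (1 + |·|²)²` is a strict supersolution at large speed
(`ν⁻¹ K₂ Φ → (2/3) Φ`, `lintegral_gain_fst_quarticWeight_le` and the sharp `ν ≥ π|v|`), and the truncation
`W_N = max (Φ, e^{|·|²/4}/N)` makes the a-priori bound part of the weight: `m_N = sup |ψ|/W_N ≤ A N`,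
`m_N ≤ (3/4) m_N + D` (`abs_le_threeQuarter_weight_add_of_fixedPoint` off a fixed ball, the a-priori bound
on it), so `m_N ≤ 4D` uniformly in `N`, and `N → ∞`. The exponent is not optimal (any `(1+|v|²)^{1+δ}`
is a supersolution; the true growth of the orthogonal inverse is `|v|²`,
`LinearizedBoltzmannOrthogonalInverseUnbounded`). [folklore] -/
theorem exists_abs_le_mul_quartic_of_fixedPoint :
    ∃ C : ℝ, 0 < C ∧ ∀ (ψ g : EuclideanSpace ℝ (Fin 3) → ℝ) (A B b : ℝ), Measurable ψ →
      (∀ x, |ψ x| ≤ A * Real.exp (‖x‖ ^ 2 / 4)) →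
      MemLp ψ 2 (stdGaussian (EuclideanSpace ℝ (Fin 3))) →
      (eLpNorm ψ 2 (stdGaussian (EuclideanSpace ℝ (Fin 3)))).toReal ≤ B →
      (∀ v, |g v| ≤ b) →
      (∀ v, collisionFrequency v * ψ v =
        (∫ w, ∫ ω, hardSphereKernel (v, w) ω * (ψ (collide ω (v, w)).1 + ψ (collide ω (v, w)).2 - ψ w)
          ∂sphereMeasure ∂stdGaussian (EuclideanSpace ℝ (Fin 3))) - g v) →
      ∀ v, |ψ v| ≤ C * (A + B + b) * (1 + ‖v‖ ^ 2) ^ 2 := by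
  -- the constants
  obtain ⟨K4, hK40, hK4⟩ := exists_lintegral_gain_fst_gaussWeight_le (θ := 1 / 4) (by norm_num) (by norm_num)
  obtain ⟨ν₀, hν₀, hν₀le⟩ := exists_pos_le_collisionFrequency (E := EuclideanSpace ℝ (Fin 3)) (by simp)
  set S : ℝ := (sphereMeasure : Measure (sphere (0 : EuclideanSpace ℝ (Fin 3)) 1)).real univ with hS
  have hS0 : 0 ≤ S := measureReal_nonneg
  set m₅ : ℝ := ∫ w, (1 + ‖w‖) ^ 5 ∂stdGaussian (EuclideanSpace ℝ (Fin 3)) with hm₅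
  have hm₅0 : 0 ≤ m₅ := integral_nonneg fun w => by positivity
  set C₂ : ℝ := S * (((∫⁻ w, ENNReal.ofReal ((1 + ‖w‖) ^ 2) ∂stdGaussian (EuclideanSpace ℝ (Fin 3))) ^ (1 / 2 : ℝ)).toReal) *
      (1 / ν₀ + 1 / Real.pi) + 1 / ν₀ with hC₂
  have hC₂0 : 0 ≤ C₂ := by
    rw [hC₂]
    exact add_nonneg (mul_nonneg (mul_nonneg hS0 ENNReal.toReal_nonneg)
      (add_nonneg (by positivity) (by positivity))) (by positivity)
  have hq1 : 0 ≤ 96 * (3 * S * m₅) / Real.pi :=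
    div_nonneg (mul_nonneg (by norm_num) (mul_nonneg (mul_nonneg (by norm_num) hS0) hm₅0)) Real.pi_pos.le
  have hq2 : 0 ≤ 96 * K4 / Real.pi := div_nonneg (mul_nonneg (by norm_num) hK40) Real.pi_pos.le
  set R₀ : ℝ := 4 + 96 * (3 * S * m₅) / Real.pi + 96 * K4 / Real.pi + 1 with hR₀
  have hR₀4 : 4 ≤ R₀ := by rw [hR₀]; linarith
  set E₀ : ℝ := Real.exp (R₀ ^ 2 / 4) with hE₀
  refine ⟨4 * (C₂ + E₀), by positivity, fun ψ g A B b hψm hψA hψ2 hB hgb hfix => ?_⟩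
  have hA0 : 0 ≤ A := by
    have h := hψA 0
    rw [norm_zero] at h
    norm_num at h
    exact (abs_nonneg _).trans h
  have hB0 : 0 ≤ B := ENNReal.toReal_nonneg.trans hB
  have hb0 : 0 ≤ b := (abs_nonneg _).trans (hgb 0)
  set D : ℝ := C₂ * (B + b) + A * E₀ with hD
  -- the estimate with the truncated weight, uniformly in `N`
  have key : ∀ N : ℝ, 0 < N → ∀ y,
      |ψ y| ≤ 4 * D * max ((1 + ‖y‖ ^ 2) ^ 2) (Real.exp ((1 / 4 : ℝ) * ‖y‖ ^ 2) / N) := by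
    intro N hN
    set W : EuclideanSpace ℝ (Fin 3) → ℝ := fun y =>
      max ((1 + ‖y‖ ^ 2) ^ 2) (Real.exp ((1 / 4 : ℝ) * ‖y‖ ^ 2) / N) with hW
    have hW1 : ∀ y, 1 ≤ W y := fun y => le_max_of_le_left (by nlinarith [norm_nonneg y])
    have hWpos : ∀ y, 0 < W y := fun y => one_pos.trans_le (hW1 y)
    have hTb : BddAbove (Set.range fun y => |ψ y| / W y) := by
      refine ⟨A * N, ?_⟩
      rintro _ ⟨y, rfl⟩
      rw [div_le_iff₀ (hWpos y)]
      have h4 : Real.exp (‖y‖ ^ 2 / 4) = N * (Real.exp ((1 / 4 : ℝ) * ‖y‖ ^ 2) / N) := by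
        rw [show ‖y‖ ^ 2 / 4 = (1 / 4 : ℝ) * ‖y‖ ^ 2 by ring]; field_simp
      calc |ψ y| ≤ A * Real.exp (‖y‖ ^ 2 / 4) := hψA y
        _ = A * N * (Real.exp ((1 / 4 : ℝ) * ‖y‖ ^ 2) / N) := by rw [h4]; ring
        _ ≤ A * N * W y := mul_le_mul_of_nonneg_left (le_max_right _ _) (by positivity)
    set m : ℝ := sSup (Set.range fun y => |ψ y| / W y) with hm
    have hle_m : ∀ y, |ψ y| / W y ≤ m := fun y => le_csSup hTb ⟨y, rfl⟩
    have hm0 : 0 ≤ m := (div_nonneg (abs_nonneg _) (hWpos 0).le).trans (hle_m 0)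
    have hdom : ∀ y, |ψ y| ≤ m * W y := fun y => by
      have := hle_m y; rwa [div_le_iff₀ (hWpos y)] at this
    have himp : ∀ y, |ψ y| / W y ≤ 3 / 4 * m + D := by
      intro y
      rw [div_le_iff₀ (hWpos y)]
      rcases lt_or_ge ‖y‖ R₀ with hy | hy
      · -- on the ball: the a-priori bound
        have h2 : |ψ y| ≤ A * E₀ := by
          refine (hψA y).trans (mul_le_mul_of_nonneg_left (Real.exp_le_exp.2 ?_) hA0)
          have := pow_le_pow_left₀ (norm_nonneg y) hy.le 2
          linarith
        have h3 : A * E₀ ≤ (3 / 4 * m + D) * W y := by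
          have : A * E₀ ≤ 3 / 4 * m + D := by
            rw [hD]; nlinarith [mul_nonneg hC₂0 (add_nonneg hB0 hb0)]
          exact this.trans (le_mul_of_one_le_right (by positivity) (hW1 y))
        exact h2.trans h3
      · -- off the ball: absorption
        have hy1 : 4 ≤ ‖y‖ := hR₀4.trans hy
        have hyn : 0 < ‖y‖ := by linarith
        have hy0 : y ≠ 0 := norm_pos_iff.1 hyn
        have hy2 : 96 * (3 * S * m₅) ≤ Real.pi * ‖y‖ := by
          have : 96 * (3 * S * m₅) / Real.pi ≤ ‖y‖ := by
            rw [hR₀] at hy; linarith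
          rwa [div_le_iff₀' Real.pi_pos] at this
        have hy3 : 96 * K4 ≤ Real.pi * ‖y‖ ^ 2 := by
          have h1 : 96 * K4 / Real.pi ≤ ‖y‖ := by
            rw [hR₀] at hy; linarith
          rw [div_le_iff₀' Real.pi_pos] at h1
          have : Real.pi * ‖y‖ ≤ Real.pi * ‖y‖ ^ 2 := mul_le_mul_of_nonneg_left (by nlinarith) Real.pi_pos.le
          linarith
        have h := abs_le_threeQuarter_weight_add_of_fixedPoint hψm hψ2 hN hm0 hK40 hB0 hb0 hν₀ hdom hB hy1
          hy2 hy3 (hν₀le y) (hgb y) (hK4 y hy0) (hfix y)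
        rw [← hS, ← hC₂] at h
        have hC₂W : C₂ * (B + b) ≤ D * W y := by
          have : C₂ * (B + b) ≤ D := by rw [hD]; nlinarith [mul_nonneg hA0 (Real.exp_nonneg (R₀ ^ 2 / 4))]
          exact this.trans (le_mul_of_one_le_right ((mul_nonneg hC₂0 (add_nonneg hB0 hb0)).trans this) (hW1 y))
        calc |ψ y| ≤ 3 / 4 * m * W y + C₂ * (B + b) := h
          _ ≤ 3 / 4 * m * W y + D * W y := add_le_add le_rfl hC₂W
          _ = (3 / 4 * m + D) * W y := by ring
    have hm_le : m ≤ 3 / 4 * m + D := csSup_le ⟨_, ⟨0, rfl⟩⟩ (by rintro _ ⟨y, rfl⟩; exact himp y)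
    have hm2 : m ≤ 4 * D := by linarith
    intro y
    exact (hdom y).trans (mul_le_mul_of_nonneg_right hm2 (hWpos y).le)
  -- `N → ∞`
  intro v
  have hN : 0 < Real.exp ((1 / 4 : ℝ) * ‖v‖ ^ 2) := Real.exp_pos _
  have h := key _ hN v
  have h1 : (1 : ℝ) ≤ (1 + ‖v‖ ^ 2) ^ 2 := by nlinarith [norm_nonneg v]
  rw [div_self hN.ne', max_eq_left h1] at h
  refine h.trans (mul_le_mul_of_nonneg_right ?_ (by positivity))
  rw [hD]
  nlinarith [mul_nonneg hC₂0 hA0, mul_nonneg (Real.exp_nonneg (R₀ ^ 2 / 4)) (add_nonneg hB0 hb0)]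

/-- **The Chapman–Enskog inverse of the linearised hard-sphere operator in `ℝ³` with polynomial
growth.** There are absolute constants `λ > 0` (the spectral gap) and `C > 0` such that every bounded
continuous `g` on `ℝ³` which is `M`-orthogonal to the collision invariants `span {1, v, |v|²}` has a
continuous pre-image `ψ₀` under the linearised hard-sphere operator, `L ψ₀ (v) = g(v)` at every `v`, with
`ψ₀ ∈ L²(M dv)`, `λ ‖ψ₀‖_{L²(M)} ≤ ‖g‖_{L²(M)}`, `ψ₀ ⊥_M` the collision invariants, and the polynomial bound
**`|ψ₀(v)| ≤ C ‖g‖_∞ (1 + |v|²)²`**. Assembly of `exists_continuous_inverse_hardSphereLinearizedOp`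
(existence, Gaussian growth) and `exists_abs_le_mul_quartic_of_fixedPoint` (Grad 1963 / Guo 2010 weighted
sup-norm scheme with the quartic weight). By `LinearizedBoltzmannOrthogonalInverseUnbounded` the exponent
cannot be lowered to `0` for this `M`-orthogonal `ψ₀` (its true growth is quadratic in general).
[cite: CIPDiluteGases1994, §7.2 Thm 7.2.1 and Thm 7.2.5] -/
theorem exists_continuous_inverse_hardSphereLinearizedOp_quartic :
    ∃ lam C : ℝ, 0 < lam ∧ 0 < C ∧
      ∀ (g : EuclideanSpace ℝ (Fin 3) → ℝ) (b : ℝ), Continuous g → (∀ v, |g v| ≤ b) →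
      (∀ φ ∈ collisionInvariants (EuclideanSpace ℝ (Fin 3)), maxwellianInner g φ = 0) →
      ∃ ψ₀ : EuclideanSpace ℝ (Fin 3) → ℝ, Continuous ψ₀ ∧
        (∀ v, |ψ₀ v| ≤ C * b * (1 + ‖v‖ ^ 2) ^ 2) ∧
        MemLp ψ₀ 2 (stdGaussian (EuclideanSpace ℝ (Fin 3))) ∧
        lam * (eLpNorm ψ₀ 2 (stdGaussian (EuclideanSpace ℝ (Fin 3)))).toReal ≤
          (eLpNorm g 2 (stdGaussian (EuclideanSpace ℝ (Fin 3)))).toReal ∧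
        (∀ φ ∈ collisionInvariants (EuclideanSpace ℝ (Fin 3)), maxwellianInner ψ₀ φ = 0) ∧
        ∀ v, hardSphereLinearizedOp ψ₀ v = g v := by
  obtain ⟨lam, C₀, hlam, hC₀, hex⟩ := exists_continuous_inverse_hardSphereLinearizedOp
  obtain ⟨C, hC, hCb⟩ := exists_abs_le_mul_quartic_of_fixedPoint
  refine ⟨lam, C * (C₀ + 1 / lam + 1), hlam, by positivity, fun g b hg hb horth => ?_⟩
  obtain ⟨ψ₀, hcont, hgrowth, hmem, hnorm, horth', hL⟩ := hex g b hg hb horth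
  refine ⟨ψ₀, hcont, fun v => ?_, hmem, hnorm, horth', hL⟩
  have hψm : Measurable ψ₀ := hcont.measurable
  have hfix : ∀ v, collisionFrequency v * ψ₀ v =
      (∫ w, ∫ ω, hardSphereKernel (v, w) ω * (ψ₀ (collide ω (v, w)).1 + ψ₀ (collide ω (v, w)).2 - ψ₀ w)
        ∂sphereMeasure ∂stdGaussian (EuclideanSpace ℝ (Fin 3))) - g v := by
    intro v
    have h := hardSphereLinearizedOp_eq_kernel_sub_of_gaussGrowth hψm hgrowth v
    rw [hL v] at h
    linarith
  have hB : (eLpNorm ψ₀ 2 (stdGaussian (EuclideanSpace ℝ (Fin 3)))).toReal ≤ b / lam := by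
    rw [le_div_iff₀ hlam, mul_comm]
    have hb0 : 0 ≤ b := (abs_nonneg _).trans (hb 0)
    have hg2 : (eLpNorm g 2 (stdGaussian (EuclideanSpace ℝ (Fin 3)))).toReal ≤ b := by
      have h := eLpNorm_le_of_ae_bound (p := 2) (μ := stdGaussian (EuclideanSpace ℝ (Fin 3))) (f := g) (C := b)
        (Eventually.of_forall fun v => by rw [Real.norm_eq_abs]; exact hb v)
      simp only [measure_univ, ENNReal.one_rpow, one_mul] at h
      exact (ENNReal.toReal_mono ENNReal.ofReal_ne_top h).trans (by rw [ENNReal.toReal_ofReal hb0])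
    exact hnorm.trans hg2
  have h := hCb ψ₀ g (C₀ * b) (b / lam) b hψm hgrowth hmem hB hb hfix v
  refine h.trans (le_of_eq ?_)
  field_simp

end

end Literature.Analysis.UnboundedOperators
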